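import Summits.RiemannHypothesis.RiemannHypothesis.Theorems.IntegerScrewCensusFloor112D

/-!
# Route `IntegerScrew` — census cell `M112-T440-dd` in the kernel: the DUAL checker on the cells `83 ≤ c < 107` (part E)

KERNEL FACTS (`decide +kernel`): `dualCheckW 111 440 40 EB 6000 a b … = true` on sub-ranges of `[83, 107)` for the dual
certificate literal `dpats112/deps112` of `IntegerScrewCensusFloor112A`.  RH-free; nothing here bears on the truth of RH.
-/

set_option linter.dupNamespace false
set_option autoImplicit false

namespace Summit.RiemannHypothesis.RiemannHypothesis.Theorems.IntegerScrew.Manifest.Fast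

open Literature.Analysis.ValidatedNumerics Literature.Analysis.ValidatedNumerics.Numerics

set_option maxRecDepth 200000 in
set_option maxHeartbeats 0 in
/-- KERNEL FACT: the cells `83 ≤ c < 91` pass. -/
theorem dualCheckW_112_83_91 : dualCheckW 111 440 40 EB 6000 83 91 logs113s dpats112 deps112 = true := by
  decide +kernel

set_option maxRecDepth 200000 in
set_option maxHeartbeats 0 in
/-- KERNEL FACT: the cells `91 ≤ c < 99` pass. -/
theorem dualCheckW_112_91_99 : dualCheckW 111 440 40 EB 6000 91 99 logs113s dpats112 deps112 = true := by
  decide +kernel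

set_option maxRecDepth 200000 in
set_option maxHeartbeats 0 in
/-- KERNEL FACT: the cells `99 ≤ c < 107` pass. -/
theorem dualCheckW_112_99_107 : dualCheckW 111 440 40 EB 6000 99 107 logs113s dpats112 deps112 = true := by
  decide +kernel

end Summit.RiemannHypothesis.RiemannHypothesis.Theorems.IntegerScrew.Manifest.Fast
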